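import Mathlib
import HarnessLib
import Summits.NavierStokesRegularity.NavierStokesRegularity.Theorems.QuarterLogPincerLimitSilenceDefs
import Literature.Analysis.FluidPDE.ClassicalSolutionRescale

/-!
# Route `QuarterLogPincer`, crux `TypeIQuantSubcubicExp` (stmt-NavierStokesRegularity-24077), line `limit_silence` —
# L1a `stub_failingFamily : Normalisation` BY NAME (parabolic rescaling)

ns-idea-7's line `Cruxes/TypeIQuantSubcubicExp/Lines/limit_silence.lean` (v1, cc13b3316587; idea-crit-4 g8 PASS
2026-08-29T06:13Z) reduces silencing_cost's Sc′ `ThickBoxSilencingCost` to three stubs; L1a `Normalisation :=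
¬ ThickBoxSilencingCost → FailingFamily` is the NORMALISATION step (size M, «Lean calculus, certainly true»): the
negation of the target, read at thickness `K := Γ₂ + n` and floor `c := min δ (1/(n+1))`, hands for every `n` a bad
configuration `(ω, y, σ, t, t₁)`; its parabolic rescaling `ω̃ s z := σ² • ω (t + σ² s) (y + σ z)` on
`[0, (t₁ − t)/σ²] × ℝ³` has the unit-scale box bounds (`σ²·Bσ⁻² = B`, `σ³·Bσ⁻³ = B`,
`(∂ₛ − Δ_z)ω̃ = σ⁴ (∂ₜ − Δₓ)ω`), initial enstrophy `σ · (δ/σ) = δ` on `B(0, Γ₂)` and final enstrophy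
`< σ · (c/σ) = c ≤ 1/(n+1)` on `B(0, Γ₂ + n)`.  This file proves it over the landed objects
(`…Theorems.QuarterLogPincerLimitSilenceDefs`) with the tree's rescaling dictionary
(`Literature.Analysis.FluidPDE.ClassicalSolutionRescale` / `SpaceTimeRescaling`: `stPull`,
`IsSmoothSpaceTimeOn.smul_stPull`, `timeDerivWithin_smul_stPull`, `laplacian_stPull`, `fderiv_stPull`,
`lintegral_comp_space_affine`).

* `preimage_affine_Icc` — `{r | t + σ² r ∈ [t, t₁]} = [0, (t₁ − t)/σ²]`;
* `setLIntegral_ball_comp_affine` — `∫⁻_{B(0,R)} F(y + σ z) dz = σ⁻³ ∫⁻_{B(y, σR)} F`;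
* `stub_failingFamily : Normalisation` — L1a, by name.

HONEST FRAME: an implication between two Props about a parabolic-inequality class (no Navier–Stokes object); it
closes one registered stub of a line four levels below the crux; nothing here bears on Sc′, 24077's truth, W7 or
Navier–Stokes regularity (OPEN / not proved).  pub-ns-dss typer (g38), `--supports stmt-NavierStokesRegularity-24077`.
-/

noncomputable section

set_option linter.dupNamespace false

namespace Summit.NavierStokesRegularity.NavierStokesRegularity.Cruxes.TypeIQuantSubcubicExp.LimitSilence

open MeasureTheory Set Function Filter Topology Metric
open scoped ENNReal NNReal Laplacian RealInnerProductSpace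
open Literature.Analysis Literature.Analysis.FluidPDE

/-! ### Two rescaling identities -/

/-- The time window of the parabolic rescaling: `{r | t + σ² r ∈ [t, t₁]} = [0, (t₁ − t)/σ²]` for `σ ≠ 0`. -/
theorem preimage_affine_Icc {σ t t₁ : ℝ} (hσ : 0 < σ) :
    (fun r => t + σ ^ 2 * r) ⁻¹' Icc t t₁ = Icc 0 ((t₁ - t) / σ ^ 2) := by
  have hσ2 : 0 < σ ^ 2 := by positivity
  ext r
  simp only [mem_preimage, mem_Icc]
  constructor
  · rintro ⟨h1, h2⟩
    refine ⟨?_, ?_⟩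
    · nlinarith
    · rw [le_div_iff₀ hσ2]; linarith
  · rintro ⟨h1, h2⟩
    rw [le_div_iff₀ hσ2] at h2
    constructor <;> nlinarith

/-- Change of variables `x = y + σ z` in a lower integral over a ball of `ℝ³`:
`∫⁻_{B(0,R)} F(y + σ z) dz = (σ³)⁻¹ ∫⁻_{B(y, σR)} F(x) dx`. -/
theorem setLIntegral_ball_comp_affine {σ : ℝ} (hσ : 0 < σ) (y : EuclideanSpace ℝ (Fin 3)) (R : ℝ)
    (F : EuclideanSpace ℝ (Fin 3) → ℝ≥0∞) :
    ∫⁻ z in ball (0 : EuclideanSpace ℝ (Fin 3)) R, F (y + σ • z) =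
      ENNReal.ofReal (σ ^ 3)⁻¹ * ∫⁻ x in ball y (σ * R), F x := by
  have hind : (ball (0 : EuclideanSpace ℝ (Fin 3)) R).indicator (fun z => F (y + σ • z)) =
      fun z => (ball y (σ * R)).indicator F (y + σ • z) := by
    funext z
    have hiff : z ∈ ball (0 : EuclideanSpace ℝ (Fin 3)) R ↔ y + σ • z ∈ ball y (σ * R) := by
      rw [mem_ball, mem_ball, dist_zero_right, dist_eq_norm, add_sub_cancel_left, norm_smul,
        Real.norm_of_nonneg hσ.le]
      exact ⟨fun h => mul_lt_mul_of_pos_left h hσ, fun h => lt_of_mul_lt_mul_left h hσ.le⟩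
    by_cases hz : z ∈ ball (0 : EuclideanSpace ℝ (Fin 3)) R
    · rw [indicator_of_mem hz, indicator_of_mem (hiff.1 hz)]
    · rw [indicator_of_notMem hz, indicator_of_notMem (fun h => hz (hiff.2 h))]
  rw [← lintegral_indicator measurableSet_ball, hind,
    lintegral_comp_space_affine hσ y ((ball y (σ * R)).indicator F), finrank_euclideanSpace_fin,
    lintegral_indicator measurableSet_ball]

/-! ### L1a -/

/-- **L1a — `stub_failingFamily : Normalisation` (BY NAME).**  The negation of `ThickBoxSilencingCost` yields a
normalised failing family: at `K := Γ₂ + n`, `c := min δ (1/(n+1))` it hands a bad configuration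
`(ω, y, σ, t, t₁)`, and `ω̃ := σ² • stPull σ² σ t y ω` (i.e. `ω̃ s z = σ² ω(t + σ² s, y + σ z)`) with span
`s₁ := (t₁ − t)/σ² ∈ (0, 1]` satisfies every clause of `FailingFamily` at index `n`. -/
theorem stub_failingFamily : Normalisation := by
  intro hneg
  unfold ThickBoxSilencingCost at hneg
  push Not at hneg
  obtain ⟨B, δ, Γ₂, hB, hδ, hΓ₂, hbad⟩ := hneg
  refine ⟨B, δ, Γ₂, hB, hδ, hΓ₂, fun n => ?_⟩
  -- the bad configuration at thickness `Γ₂ + n` and floor `min δ (1/(n+1))`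
  set K : ℝ := Γ₂ + n with hK
  set c : ℝ := min δ (1 / ((n : ℝ) + 1)) with hc
  have hn0 : (0 : ℝ) ≤ n := Nat.cast_nonneg n
  have hKΓ : Γ₂ ≤ K := by rw [hK]; linarith
  have hcpos : 0 < c := lt_min hδ (by positivity)
  have hcδ : c ≤ δ := min_le_left _ _
  obtain ⟨ω, y, σ, t, t₁, hσ, htt₁, ht₁, hsm, hbox, hinit, hfinal⟩ := hbad K c hKΓ hcpos hcδ
  have hσ2 : 0 < σ ^ 2 := by positivity
  have hσ20 : σ ^ 2 ≠ 0 := hσ2.ne'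
  -- the rescaled field and its span
  set ωr : ℝ → EuclideanSpace ℝ (Fin 3) → EuclideanSpace ℝ (Fin 3) := σ ^ 2 • stPull (σ ^ 2) σ t y ω with hωr
  set s₁ : ℝ := (t₁ - t) / σ ^ 2 with hs₁
  have hωr_apply : ∀ s z, ωr s z = σ ^ 2 • ω (t + σ ^ 2 * s) (y + σ • z) := fun s z => by
    simp only [hωr, Pi.smul_apply, stPull_apply]
  have hpre : (fun r => t + σ ^ 2 * r) ⁻¹' Icc t t₁ = Icc 0 s₁ := preimage_affine_Icc hσ
  have hs₁pos : 0 < s₁ := div_pos (by linarith) hσ2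
  have hs₁le : s₁ ≤ 1 := by rw [hs₁, div_le_one hσ2]; linarith
  have hts₁ : t + σ ^ 2 * s₁ = t₁ := by rw [hs₁]; field_simp; ring
  -- dictionary: a rescaled point lies in the original box
  have htime : ∀ {s : ℝ}, s ∈ Icc 0 s₁ → t + σ ^ 2 * s ∈ Icc t t₁ := fun {s} hs => by
    have : s ∈ (fun r => t + σ ^ 2 * r) ⁻¹' Icc t t₁ := by rw [hpre]; exact hs
    exact this
  have hspace : ∀ {z : EuclideanSpace ℝ (Fin 3)}, z ∈ ball (0 : EuclideanSpace ℝ (Fin 3)) (2 * (Γ₂ + n)) →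
      y + σ • z ∈ ball y (2 * K * σ) := fun {z} hz => by
    rw [mem_ball, dist_zero_right] at hz
    rw [mem_ball, dist_eq_norm, add_sub_cancel_left, norm_smul, Real.norm_of_nonneg hσ.le, hK]
    nlinarith
  -- the powers of `σ`
  have hpow2 : σ ^ (-(2 : ℝ)) = (σ ^ 2)⁻¹ := by rw [Real.rpow_neg hσ.le, Real.rpow_two]
  have hpow3 : σ ^ (-(3 : ℝ)) = (σ ^ 3)⁻¹ := by
    rw [Real.rpow_neg hσ.le, show (3 : ℝ) = ((3 : ℕ) : ℝ) by norm_num, Real.rpow_natCast]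
  have hpow1 : σ ^ (-(1 : ℝ)) = σ⁻¹ := Real.rpow_neg_one σ
  -- the three pointwise identities of the rescaling
  have hval : ∀ s z, ‖ωr s z‖ = σ ^ 2 * ‖ω (t + σ ^ 2 * s) (y + σ • z)‖ := fun s z => by
    rw [hωr_apply, norm_smul, Real.norm_of_nonneg hσ2.le]
  have hgrad : ∀ {s : ℝ}, s ∈ Icc 0 s₁ → ∀ z,
      ‖fderiv ℝ (ωr s) z‖ = σ ^ 3 * ‖fderiv ℝ (ω (t + σ ^ 2 * s)) (y + σ • z)‖ := fun {s} hs z => by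
    have hdiff : Differentiable ℝ (stPull (σ ^ 2) σ t y ω s) :=
      differentiable_stPull_slice ((hsm.contDiff_slice (htime hs)).differentiable (by simp))
    have h1 : ωr s = σ ^ 2 • stPull (σ ^ 2) σ t y ω s := rfl
    rw [h1, fderiv_const_smul (hdiff z), fderiv_stPull, smul_smul, norm_smul,
      Real.norm_of_nonneg (by positivity)]
    ring
  have heqn : ∀ {s : ℝ}, s ∈ Icc 0 s₁ → ∀ z,
      ‖timeDerivWithin (Icc 0 s₁) ωr s z - (Δ (ωr s)) z‖ =
        σ ^ 4 * ‖timeDerivWithin (Icc t t₁) ω (t + σ ^ 2 * s) (y + σ • z) -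
          (Δ (ω (t + σ ^ 2 * s))) (y + σ • z)‖ := fun {s} hs z => by
    have h2 : ContDiff ℝ 2 (ω (t + σ ^ 2 * s)) := (hsm.contDiff_slice (htime hs)).of_le (by norm_cast)
    have h2' : ContDiffAt ℝ 2 (stPull (σ ^ 2) σ t y ω s) z := (contDiff_stPull_slice h2).contDiffAt
    have htd : timeDerivWithin (Icc 0 s₁) ωr s z =
        (σ ^ 2 * σ ^ 2) • timeDerivWithin (Icc t t₁) ω (t + σ ^ 2 * s) (y + σ • z) := by
      rw [← hpre, hωr]
      exact timeDerivWithin_smul_stPull (Icc t t₁) ω (σ ^ 2) hσ20 σ t y s z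
    have hlap : (Δ (ωr s)) z = (σ ^ 2 * σ ^ 2) • (Δ (ω (t + σ ^ 2 * s))) (y + σ • z) := by
      rw [show ωr s = σ ^ 2 • stPull (σ ^ 2) σ t y ω s from rfl, InnerProductSpace.laplacian_smul _ h2',
        laplacian_stPull (σ ^ 2) σ t y ω s z h2, smul_smul]
    rw [htd, hlap, ← smul_sub, norm_smul, Real.norm_of_nonneg (by positivity)]
    ring
  -- the `L²` masses: `∫⁻_{B(0,R)} ‖ω̃(s)‖² = σ ∫⁻_{B(y,σR)} ‖ω(t + σ² s)‖²`
  have hconst : ENNReal.ofReal (σ ^ 2) ^ 2 * ENNReal.ofReal (σ ^ 3)⁻¹ = ENNReal.ofReal σ := by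
    rw [← ENNReal.ofReal_pow hσ2.le, ← ENNReal.ofReal_mul (by positivity)]
    congr 1
    rw [← div_eq_mul_inv, div_eq_iff (by positivity)]
    ring
  have hmass : ∀ s R, ∫⁻ z in ball (0 : EuclideanSpace ℝ (Fin 3)) R, ‖ωr s z‖ₑ ^ 2 =
      ENNReal.ofReal σ * ∫⁻ x in ball y (σ * R), ‖ω (t + σ ^ 2 * s) x‖ₑ ^ 2 := fun s R => by
    have h1 : ∀ z, ‖ωr s z‖ₑ ^ 2 =
        ENNReal.ofReal (σ ^ 2) ^ 2 * ‖ω (t + σ ^ 2 * s) (y + σ • z)‖ₑ ^ 2 := fun z => by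
      rw [hωr_apply, enorm_smul, Real.enorm_eq_ofReal hσ2.le, mul_pow]
    simp_rw [h1]
    rw [lintegral_const_mul' _ _ (ENNReal.pow_ne_top ENNReal.ofReal_ne_top),
      setLIntegral_ball_comp_affine hσ y R (fun x => ‖ω (t + σ ^ 2 * s) x‖ₑ ^ 2), ← mul_assoc, hconst]
  have hσE : ENNReal.ofReal σ ≠ 0 := (ENNReal.ofReal_pos.2 hσ).ne'
  refine ⟨ωr, s₁, hs₁pos, hs₁le, ?_, ?_, ?_, ?_⟩
  · -- joint smoothness on the rescaled window
    have h := hsm.smul_stPull (σ ^ 2) (σ ^ 2) σ t y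
    rw [hpre] at h
    exact h
  · -- the unit-scale box bounds and differential inequality
    intro s hs z hz
    obtain ⟨h0, h1, h2⟩ := hbox (t + σ ^ 2 * s) (htime hs) (y + σ • z) (hspace hz)
    refine ⟨?_, ?_, ?_⟩
    · rw [hval]
      rw [hpow2] at h0
      calc σ ^ 2 * ‖ω (t + σ ^ 2 * s) (y + σ • z)‖ ≤ σ ^ 2 * (B * (σ ^ 2)⁻¹) :=
            mul_le_mul_of_nonneg_left h0 hσ2.le
        _ = B := by field_simp
    · rw [hgrad hs]
      rw [hpow3] at h1
      calc σ ^ 3 * ‖fderiv ℝ (ω (t + σ ^ 2 * s)) (y + σ • z)‖ ≤ σ ^ 3 * (B * (σ ^ 3)⁻¹) :=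
            mul_le_mul_of_nonneg_left h1 (by positivity)
        _ = B := by field_simp
    · rw [heqn hs, hval, hgrad hs]
      rw [hpow2, hpow1] at h2
      calc σ ^ 4 * ‖timeDerivWithin (Icc t t₁) ω (t + σ ^ 2 * s) (y + σ • z) -
              (Δ (ω (t + σ ^ 2 * s))) (y + σ • z)‖
          ≤ σ ^ 4 * (B * (σ ^ 2)⁻¹ * ‖ω (t + σ ^ 2 * s) (y + σ • z)‖ +
              B * σ⁻¹ * ‖fderiv ℝ (ω (t + σ ^ 2 * s)) (y + σ • z)‖) :=
            mul_le_mul_of_nonneg_left h2 (by positivity)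
        _ = B * (σ ^ 4 * (σ ^ 2)⁻¹) * ‖ω (t + σ ^ 2 * s) (y + σ • z)‖ +
              B * (σ ^ 4 * σ⁻¹) * ‖fderiv ℝ (ω (t + σ ^ 2 * s)) (y + σ • z)‖ := by ring
        _ = B * (σ ^ 2 * ‖ω (t + σ ^ 2 * s) (y + σ • z)‖) +
              B * (σ ^ 3 * ‖fderiv ℝ (ω (t + σ ^ 2 * s)) (y + σ • z)‖) := by
            rw [show σ ^ 4 * (σ ^ 2)⁻¹ = σ ^ 2 by
                  rw [show σ ^ 4 = σ ^ 2 * σ ^ 2 by ring, mul_assoc, mul_inv_cancel₀ hσ20, mul_one],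
              show σ ^ 4 * σ⁻¹ = σ ^ 3 by
                  rw [show σ ^ 4 = σ ^ 3 * σ by ring, mul_assoc, mul_inv_cancel₀ hσ.ne', mul_one]]
            ring
  · -- initial enstrophy `≥ δ` on `B(0, Γ₂)`
    rw [hmass 0 Γ₂, mul_zero, add_zero, mul_comm σ Γ₂]
    calc ENNReal.ofReal δ = ENNReal.ofReal σ * ENNReal.ofReal (δ / σ) := by
          rw [← ENNReal.ofReal_mul hσ.le]
          congr 1
          field_simp
      _ ≤ ENNReal.ofReal σ * ∫⁻ x in ball y (Γ₂ * σ), ‖ω t x‖ₑ ^ 2 := by gcongr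
  · -- final enstrophy `< 1/(n+1)` on `B(0, Γ₂ + n)`
    rw [hmass s₁ (Γ₂ + n), hts₁, mul_comm σ (Γ₂ + n), ← hK]
    calc ENNReal.ofReal σ * ∫⁻ x in ball y (K * σ), ‖ω t₁ x‖ₑ ^ 2
        < ENNReal.ofReal σ * ENNReal.ofReal (c / σ) :=
          ENNReal.mul_lt_mul_right hσE ENNReal.ofReal_ne_top hfinal
      _ = ENNReal.ofReal c := by
          rw [← ENNReal.ofReal_mul hσ.le]
          congr 1
          field_simp
      _ ≤ ENNReal.ofReal (1 / ((n : ℝ) + 1)) := ENNReal.ofReal_le_ofReal (min_le_right _ _)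

end Summit.NavierStokesRegularity.NavierStokesRegularity.Cruxes.TypeIQuantSubcubicExp.LimitSilence

end
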